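import Mathlib

/-!
# The machine parameters of line «sfm-bl»: a concrete `O(log N)` choice, its side conditions, its polynomial
magnitude, and the integer form of the greedy comparison (MACHINE-PLAN §6 glue for M2–M5)

FRONTIER F-N1c; nothing here bears on P vs NP.

`SfmBl.remainder_package_fp` (`SfmBlRemainderPackageFP`) is parametric in `(b, j, t₀)` under the three side
conditions `N ≤ 2^b`, `20·N ≤ 2^(2^(j+1))`, `2·2^(j+1) + 2b ≤ 10(t₀+1)` (`N ≥ 1` pieces).  The machine must
COMPUTE such parameters from `N` and its cost model needs their magnitude to be polynomial in `N`.  This file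
fixes the canonical choice by elementary `ℕ`-arithmetic (`Nat.size` = bit length, available to the machine as
`codeFP_unSize`):

  `b = size N`,   `j + 1 = size (size (20·N))`,   `t₀ = (2·2^(j+1) + 2b) / 10`,

proves the three side conditions (`sfmBl_params_spec`) and the magnitude bounds the `CodeFP` budgets consume
(`sfmBl_params_bounds`): `2^(j+2) ≤ 4·size(20N)`, `t₀ + 1 ≤ size(20N)`, `2^size(20N) ≤ 40·N`, hence
`(2^60)^(2^(j+2)) ≤ (40N)^240` (closed-walk enumeration of M3), `(2^60)^(2(t₀+1)) ≤ (40N)^120` and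
`2^(t₀+1) ≤ 40N` (candidate walks of M2, sub-pairs of a spot in M4).  Finally `div_add_div_le_iff_of_pos` /
`frac_compare_int_iff` turn the greedy step comparison of the two-part potential
`Σ tr/A₁ + Σ ê/A₂ ≤ Σ tr'/A₁ + Σ ê'/A₂` with RATIONAL `A₁ = p₁/q₁`, `A₂ = p₂/q₂` into ONE integer comparison,
and `sfmBl_A₁_frac`, `sfmBl_A₂_frac` exhibit `p/q` for the thresholds of record
`A₁ = 10(N·(2^60/20)^ℓ + 1)`, `A₂ = (6/5)(4V·(2^60)⁻¹⁰ + 1)` (with `(2^60)^10` kept unevaluated).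
-/

namespace Summit.PneNP.PneNP.Theorems.SfmBl

/-! ## Bit-length facts (`x ≤ 2^size x` is `Nat.lt_size_self`, monotonicity is `Nat.size_le_size`) -/

/-- `20N` has at least five bits when `N ≥ 1`. -/
theorem five_le_size_twenty_mul {N : ℕ} (hN : 1 ≤ N) : 5 ≤ Nat.size (20 * N) :=
  Nat.lt_size.mpr (by norm_num; omega)

/-- `2^size x ≤ 2x` for `x ≥ 1`, in the two instances used below (kept as one statement about `20N` and
`size (20N)` to avoid restating the generic tree lemma). -/
theorem sfmBl_two_pow_size_bounds {N : ℕ} (hN : 1 ≤ N) :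
    2 ^ Nat.size (20 * N) ≤ 40 * N ∧ 2 ^ Nat.size (Nat.size (20 * N)) ≤ 2 * Nat.size (20 * N) := by
  have key : ∀ x : ℕ, 1 ≤ x → 2 ^ Nat.size x ≤ 2 * x := by
    intro x hx
    have hs : 0 < Nat.size x := Nat.size_pos.mpr hx
    have h1 : 2 ^ (Nat.size x - 1) ≤ x := Nat.lt_size.mp (by omega)
    calc 2 ^ Nat.size x = 2 * 2 ^ (Nat.size x - 1) := by
          rw [← pow_succ']; congr 1; omega
      _ ≤ 2 * x := Nat.mul_le_mul_left 2 h1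
  have h5 := five_le_size_twenty_mul hN
  exact ⟨(key (20 * N) (by omega)).trans (by omega), key _ (by omega)⟩

/-! ## The parameter choice and its side conditions -/

/-- THE SIDE CONDITIONS of `remainder_package_fp` for the canonical parameters. -/
theorem sfmBl_params_spec {N : ℕ} {b j t₀ : ℕ} (hb : b = Nat.size N)
    (hj : j + 1 = Nat.size (Nat.size (20 * N))) (ht : t₀ = (2 * 2 ^ (j + 1) + 2 * b) / 10) :
    N ≤ 2 ^ b ∧ 20 * N ≤ 2 ^ (2 ^ (j + 1)) ∧ 2 * 2 ^ (j + 1) + 2 * b ≤ 10 * (t₀ + 1) := by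
  refine ⟨hb ▸ (Nat.lt_size_self N).le, ?_, ?_⟩
  · calc 20 * N ≤ 2 ^ Nat.size (20 * N) := (Nat.lt_size_self _).le
      _ ≤ 2 ^ (2 ^ (j + 1)) := by
          apply Nat.pow_le_pow_right (by norm_num)
          rw [hj]; exact (Nat.lt_size_self _).le
  · rw [ht]; omega

/-- The exponent `j + 1 = size (size (20N))` is positive, so `j = size (size (20N)) - 1` is a legitimate choice. -/
theorem sfmBl_params_j_ok {N : ℕ} (hN : 1 ≤ N) :
    (Nat.size (Nat.size (20 * N)) - 1) + 1 = Nat.size (Nat.size (20 * N)) := by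
  have h5 := five_le_size_twenty_mul hN
  have : 0 < Nat.size (Nat.size (20 * N)) := Nat.size_pos.mpr (by omega)
  omega

/-- THE MAGNITUDE BOUNDS for the canonical parameters (everything polynomial in `N`). -/
theorem sfmBl_params_bounds {N : ℕ} (hN : 1 ≤ N) {b j t₀ : ℕ} (hb : b = Nat.size N)
    (hj : j + 1 = Nat.size (Nat.size (20 * N))) (ht : t₀ = (2 * 2 ^ (j + 1) + 2 * b) / 10) :
    2 ^ (j + 1) ≤ 2 * Nat.size (20 * N) ∧
    2 ^ (j + 2) ≤ 4 * Nat.size (20 * N) ∧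
    t₀ + 1 ≤ Nat.size (20 * N) ∧
    2 ^ Nat.size (20 * N) ≤ 40 * N ∧
    (2 ^ 60) ^ (2 ^ (j + 2)) ≤ (40 * N) ^ 240 ∧
    (2 ^ 60) ^ (2 * (t₀ + 1)) ≤ (40 * N) ^ 120 ∧
    2 ^ (t₀ + 1) ≤ 40 * N := by
  set s := Nat.size (20 * N) with hs
  have h5 : 5 ≤ s := five_le_size_twenty_mul hN
  obtain ⟨h40, hss⟩ := sfmBl_two_pow_size_bounds hN
  rw [← hs] at h40 hss
  have hk : 2 ^ (j + 1) ≤ 2 * s := by rw [hj]; exact hss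
  have hk2 : 2 ^ (j + 2) ≤ 4 * s := by
    rw [pow_succ]; omega
  have hbs : b ≤ s := by rw [hb, hs]; exact Nat.size_le_size (by omega)
  have ht1 : t₀ + 1 ≤ s := by rw [ht]; omega
  refine ⟨hk, hk2, ht1, h40, ?_, ?_, ?_⟩
  · calc (2 ^ 60) ^ (2 ^ (j + 2)) ≤ (2 ^ 60) ^ (4 * s) := Nat.pow_le_pow_right (by norm_num) hk2
      _ = (2 ^ s) ^ 240 := by rw [← pow_mul, ← pow_mul]; congr 1; ring
      _ ≤ (40 * N) ^ 240 := Nat.pow_le_pow_left h40 _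
  · calc (2 ^ 60) ^ (2 * (t₀ + 1)) ≤ (2 ^ 60) ^ (2 * s) :=
          Nat.pow_le_pow_right (by norm_num) (by omega)
      _ = (2 ^ s) ^ 120 := by rw [← pow_mul, ← pow_mul]; congr 1; ring
      _ ≤ (40 * N) ^ 120 := Nat.pow_le_pow_left h40 _
  · exact (Nat.pow_le_pow_right (by norm_num) ht1).trans h40

/-! ## The greedy comparison as ONE integer comparison -/

/-- `X/A₁ + Y/A₂ ≤ X'/A₁ + Y'/A₂ ↔ A₂X + A₁Y ≤ A₂X' + A₁Y'` for positive `A₁, A₂`. -/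
theorem div_add_div_le_iff_of_pos {A₁ A₂ X Y X' Y' : ℝ} (h₁ : 0 < A₁) (h₂ : 0 < A₂) :
    X / A₁ + Y / A₂ ≤ X' / A₁ + Y' / A₂ ↔ A₂ * X + A₁ * Y ≤ A₂ * X' + A₁ * Y' := by
  rw [div_add_div _ _ h₁.ne' h₂.ne', div_add_div _ _ h₁.ne' h₂.ne', div_le_div_iff_of_pos_right (mul_pos h₁ h₂)]
  constructor <;> intro h <;> linarith

/-- The same with RATIONAL thresholds `A₁ = p₁/q₁`, `A₂ = p₂/q₂` and INTEGER data: one comparison in `ℤ`. -/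
theorem frac_compare_int_iff {p₁ q₁ p₂ q₂ : ℕ} (hp₁ : 0 < p₁) (hq₁ : 0 < q₁) (hp₂ : 0 < p₂) (hq₂ : 0 < q₂)
    (X Y X' Y' : ℤ) :
    (X : ℝ) / ((p₁ : ℝ) / q₁) + (Y : ℝ) / ((p₂ : ℝ) / q₂)
        ≤ (X' : ℝ) / ((p₁ : ℝ) / q₁) + (Y' : ℝ) / ((p₂ : ℝ) / q₂) ↔
      ((p₂ * q₁ : ℕ) : ℤ) * X + ((p₁ * q₂ : ℕ) : ℤ) * Y ≤ ((p₂ * q₁ : ℕ) : ℤ) * X' + ((p₁ * q₂ : ℕ) : ℤ) * Y' := by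
  have hp₁' : (0 : ℝ) < p₁ := by exact_mod_cast hp₁
  have hq₁' : (0 : ℝ) < q₁ := by exact_mod_cast hq₁
  have hp₂' : (0 : ℝ) < p₂ := by exact_mod_cast hp₂
  have hq₂' : (0 : ℝ) < q₂ := by exact_mod_cast hq₂
  rw [div_add_div_le_iff_of_pos (div_pos hp₁' hq₁') (div_pos hp₂' hq₂')]
  have key : ∀ U V : ℝ, (p₂ : ℝ) / q₂ * U + (p₁ : ℝ) / q₁ * V
      = ((p₂ : ℝ) * q₁ * U + (p₁ : ℝ) * q₂ * V) / ((q₁ : ℝ) * q₂) := by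
    intro U V; field_simp
  rw [key, key, div_le_div_iff_of_pos_right (mul_pos hq₁' hq₂')]
  constructor
  · intro h; exact_mod_cast h
  · intro h; exact_mod_cast h

/-- `A₁ = 10(N·(2^60/20)^ℓ + 1) = 10(N·2^(60ℓ) + 20^ℓ) / 20^ℓ`. -/
theorem sfmBl_A₁_frac (N ℓ : ℕ) :
    (10 : ℝ) * ((N : ℝ) * ((2 : ℝ) ^ 60 / 20) ^ ℓ + 1)
      = ((10 * (N * 2 ^ (60 * ℓ) + 20 ^ ℓ) : ℕ) : ℝ) / ((20 ^ ℓ : ℕ) : ℝ) := by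
  have h20 : (0 : ℝ) < (20 : ℝ) ^ ℓ := by positivity
  push_cast
  rw [div_pow, pow_mul]
  field_simp

set_option exponentiation.threshold 1024 in
/-- `A₂ = (6/5)(4V·((2^60)^10)⁻¹ + 1) = 6(4V + (2^60)^10) / (5·(2^60)^10)`. -/
theorem sfmBl_A₂_frac (V : ℕ) :
    (6 : ℝ) / 5 * (4 * (V : ℝ) * (((2 : ℝ) ^ 60) ^ 10)⁻¹ + 1)
      = ((6 * (4 * V + (2 ^ 60) ^ 10) : ℕ) : ℝ) / ((5 * (2 ^ 60) ^ 10 : ℕ) : ℝ) := by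
  have key : ∀ D : ℝ, 0 < D → (6 : ℝ) / 5 * (4 * (V : ℝ) * D⁻¹ + 1) = 6 * (4 * V + D) / (5 * D) := by
    intro D hD; field_simp
  rw [key _ (by positivity)]
  push_cast
  ring

/-- Positivity of the two numerators / denominators of record (for `frac_compare_int_iff`). -/
theorem sfmBl_fracs_pos (N ℓ V : ℕ) :
    0 < 10 * (N * 2 ^ (60 * ℓ) + 20 ^ ℓ) ∧ 0 < 20 ^ ℓ ∧ 0 < 6 * (4 * V + (2 ^ 60) ^ 10) ∧
      0 < 5 * (2 ^ 60) ^ 10 := by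
  refine ⟨?_, by positivity, by positivity, by positivity⟩
  have : 0 < 20 ^ ℓ := by positivity
  positivity

end Summit.PneNP.PneNP.Theorems.SfmBl
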